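import Mathlib

/-!
# Route GirthSidon — crux `PolySwallowForcesShortRelation` (stmt-ValiantsHypothesis-6537), line
`two_ended_honesty`: kernel facts about TERM HOPPING (the counterexample mechanism of REDUCTION-p2 §6)

Setting (free-exponent model of the totally-born residual `stub_totallyBornTargets`): `T ⊂ ℕ` is the POOL —
the exponents `t` with `x^t ∈ W = span(1, y)` — and a reduced SOURCE is a polynomial `g` none of whose
exponents lies in `T`.  A target `x^d` is born by SINGLE-SHIFT hopping from `g` at the shift `t ∈ T` when
`x^t · g − c · x^d` has all its exponents in `T + T` (the other terms of `x^t g` are absorbed by pool products):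
then every exponent `e ≠ d − t` of `g` is ABSORBED at `t`, i.e. `e + t ∈ T + T`.

* `absorb_twice_relation`: an exponent `e ∉ T` absorbed at two distinct shifts `t ≠ t'` forces an aligned,
  non-trivial `3 + 3` additive coincidence `u + v + t' = u' + v' + t` in the pool.  (So a source hopping `q ≥ 3`
  terms needs `≥ q(q-2)` such coincidences: the pool must be additively rich while the targets stay poor.)
* `absorb_unique_of_B3`: consequently over a `B₃` pool (all `3`-fold sums distinct as multisets — this includes
  every pool met by the sparse/Sidon engines of the route) an exponent `e ∉ T` is absorbed at NO MORE THAN ONE shift;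
* `single_shift_exposure_unique_of_B3`: hence a reduced source with `≥ 3` terms is single-shift exposed at no more
  than one shift of a `B₃` pool — it contributes at most one born target this way, and the only multi-target
  single-shift sources are binomials, whose targets `e + t` (`e ∈ {ord g, deg g}`, `t ∈ T`) are cross-honest and
  fall under the cover lemma of `…HonestTargets.lean`.  Over `B₃` pools single-shift term hopping therefore yields
  `m ≤ #(cross-honest) + r` targets, never `m ≥ n^{10/9}`: the mechanism needs pools with many aligned `3+3`
  coincidences (refuter census `Cruxes/PolySwallowForcesShortRelation/TERMHOP-d1.md`).
* `multipliers_proportional_of_B3` / `depth_one_target_unique_of_B3`: the same holds for arbitrary MULTI-SHIFT multipliers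
  `h ∈ span x^T`: over a `B₃` pool all successful multipliers of a source are proportional, so a source has at most one
  depth-one target off `T+T` and off the top-born exponents `T + deg g` — `B₃` pools are immune to single-source
  depth-one hopping altogether (multi-shift capacity measured ≤ 1 in `multishift_b3.py`, ≤ 3 for Sidon pools).
* `pair_of_exposures`: for ANY pool, two exposures of one source at shifts `t, t'` with born targets
  `d, d' ∉ T+T` satisfy `d + t' = d' + t` or `d + d' ∈ (T+T)+(T+T)` — same-source target pairs are tied to the pool.
VP ≠ VNP is not moved.  [folklore]
-/

set_option linter.dupNamespace false

namespace Summit.ValiantsHypothesis.ValiantsHypothesis.Theorems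

open Polynomial
open scoped Pointwise

namespace PolySwallowForcesShortRelation.Negative.TermHop

/-- An exponent `e ∉ T` absorbed at two distinct shifts `t ≠ t'` (`e + t = u + v`, `e + t' = u' + v'` with
`u, v, u', v' ∈ T`) gives the aligned coincidence `u + v + t' = u' + v' + t`, and it is non-trivial:
`{u, v, t'} ≠ {u', v', t}` as multisets (else `t ∈ {u, v}` and `e ∈ T`). [folklore] -/
theorem absorb_twice_relation {T : Finset ℕ} {e t t' u v u' v' : ℕ} (he : e ∉ T)
    (hu : u ∈ T) (hv : v ∈ T) (h1 : e + t = u + v) (h2 : e + t' = u' + v') (htt : t ≠ t') :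
    u + v + t' = u' + v' + t ∧ ({u, v, t'} : Multiset ℕ) ≠ {u', v', t} := by
  refine ⟨by omega, fun hEq => ?_⟩
  have hmem : t ∈ ({u, v, t'} : Multiset ℕ) := by rw [hEq]; simp
  simp only [Multiset.insert_eq_cons, Multiset.mem_cons, Multiset.mem_singleton] at hmem
  rcases hmem with rfl | rfl | rfl
  · exact he (by convert hv using 1; omega)
  · exact he (by convert hu using 1; omega)
  · exact htt rfl

/-- Over a `B₃` pool (all `3`-fold sums from `T` distinct as multisets) an exponent `e ∉ T` lands in `T + T`
after at most ONE shift from `T`: `e + t ∈ T+T` and `e + t' ∈ T+T` force `t = t'`. [folklore] -/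
theorem absorb_unique_of_B3 {T : Finset ℕ}
    (hB3 : ∀ a ∈ T, ∀ b ∈ T, ∀ c ∈ T, ∀ a' ∈ T, ∀ b' ∈ T, ∀ c' ∈ T,
      a + b + c = a' + b' + c' → ({a, b, c} : Multiset ℕ) = {a', b', c'})
    {e t t' : ℕ} (he : e ∉ T) (ht : t ∈ T) (ht' : t' ∈ T)
    (h1 : e + t ∈ T + T) (h2 : e + t' ∈ T + T) : t = t' := by
  by_contra htt
  obtain ⟨u, hu, v, hv, huv⟩ := Finset.mem_add.mp h1
  obtain ⟨u', hu', v', hv', huv'⟩ := Finset.mem_add.mp h2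
  obtain ⟨hsum, hne⟩ := absorb_twice_relation (T := T) he hu hv huv.symm huv'.symm htt
  exact hne (hB3 u hu v hv t' ht' u' hu' v' hv' t ht hsum)

section Source

variable {K : Type*} [Field K]

/-- Exponents of a source other than the exposed one are absorbed: if every exponent of
`X^t * g - C c * X^d` lies in `T + T`, then each `e` in the support of `g` with `e + t ≠ d` has
`e + t ∈ T + T`. [folklore] -/
theorem absorbed_of_exposure {T : Finset ℕ} {g : K[X]} {t d : ℕ} {c : K}
    (h : ∀ n ∈ (X ^ t * g - C c * X ^ d).support, n ∈ T + T) {e : ℕ} (he : e ∈ g.support)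
    (hed : e + t ≠ d) : e + t ∈ T + T := by
  apply h
  rw [Polynomial.mem_support_iff] at he ⊢
  rw [Polynomial.coeff_sub, Polynomial.coeff_X_pow_mul, Polynomial.coeff_C_mul_X_pow, if_neg hed, sub_zero]
  exact he

/-- The exposed exponent is a term of the source: if `X^t * g - C c * X^d` has its exponents in `T + T`,
`c ≠ 0` and `d ∉ T + T`, then `t ≤ d` and `d - t` lies in the support of `g`. [folklore] -/
theorem exposed_mem_support {T : Finset ℕ} {g : K[X]} {t d : ℕ} {c : K}
    (h : ∀ n ∈ (X ^ t * g - C c * X ^ d).support, n ∈ T + T) (hc : c ≠ 0) (hd : d ∉ T + T) :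
    t ≤ d ∧ d - t ∈ g.support := by
  have h0 : (X ^ t * g - C c * X ^ d).coeff d = 0 := by
    by_contra hne
    exact hd (h d (Polynomial.mem_support_iff.mpr hne))
  rw [Polynomial.coeff_sub, Polynomial.coeff_X_pow_mul', Polynomial.coeff_C_mul_X_pow, if_pos rfl,
    sub_eq_zero] at h0
  by_cases htd : t ≤ d
  · rw [if_pos htd] at h0
    exact ⟨htd, Polynomial.mem_support_iff.mpr (by rw [h0]; exact hc)⟩
  · rw [if_neg htd] at h0
    exact absurd h0.symm hc

/-- **Single-shift hopping over a `B₃` pool exposes a source at no more than one shift.**  If `g` is a reduced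
source (no exponent in the pool `T`) with at least three terms, and `X^t * g`, `X^{t'} * g` are both monomials
`c X^d`, `c' X^{d'}` up to terms with exponents in `T + T` (`t, t' ∈ T`), then `t = t'`.  Hence such a source
yields at most one born target by single-shift hopping; multi-target single-shift sources over `B₃` pools are
binomials (cross-honest targets). [folklore] -/
theorem single_shift_exposure_unique_of_B3 {T : Finset ℕ}
    (hB3 : ∀ a ∈ T, ∀ b ∈ T, ∀ c ∈ T, ∀ a' ∈ T, ∀ b' ∈ T, ∀ c' ∈ T,
      a + b + c = a' + b' + c' → ({a, b, c} : Multiset ℕ) = {a', b', c'})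
    {g : K[X]} (hg : ∀ e ∈ g.support, e ∉ T) (hcard : 2 < g.support.card)
    {t t' d d' : ℕ} (ht : t ∈ T) (ht' : t' ∈ T) {c c' : K}
    (h1 : ∀ n ∈ (X ^ t * g - C c * X ^ d).support, n ∈ T + T)
    (h2 : ∀ n ∈ (X ^ t' * g - C c' * X ^ d').support, n ∈ T + T) : t = t' := by
  obtain ⟨e₁, e₂, e₃, he₁, he₂, he₃, h12, h13, h23⟩ := Finset.two_lt_card_iff.mp hcard
  -- among three distinct terms, one is absorbed at both shifts (each shift exposes at most one term)
  have key : ∃ e ∈ g.support, e + t ≠ d ∧ e + t' ≠ d' := by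
    by_contra hcon
    push Not at hcon
    have a1 := hcon e₁ he₁
    have a2 := hcon e₂ he₂
    have a3 := hcon e₃ he₃
    omega
  obtain ⟨e, he, hed, hed'⟩ := key
  exact absorb_unique_of_B3 hB3 (hg e he) ht ht' (absorbed_of_exposure h1 he hed)
    (absorbed_of_exposure h2 he hed')

/-- **Same-source target pairs are tied to the pool.**  For ANY pool `T`: if a source `g` is exposed at two
shifts `t, t'` with genuine born targets (`c, c' ≠ 0`, `d, d' ∉ T + T`), then either
`d + t' = d' + t` or `d + d' ∈ (T + T) + (T + T)`.  (In the free model: the exposed terms `e = d - t`,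
`e' = d' - t'` are absorbed at the other shift.) [folklore] -/
theorem pair_of_exposures {T : Finset ℕ} {g : K[X]} {t t' d d' : ℕ} {c c' : K} (hc : c ≠ 0) (hc' : c' ≠ 0) (hd : d ∉ T + T) (hd' : d' ∉ T + T)
    (h1 : ∀ n ∈ (X ^ t * g - C c * X ^ d).support, n ∈ T + T)
    (h2 : ∀ n ∈ (X ^ t' * g - C c' * X ^ d').support, n ∈ T + T) :
    d + t' = d' + t ∨ d + d' ∈ T + T + (T + T) := by
  obtain ⟨htd, he⟩ := exposed_mem_support h1 hc hd
  obtain ⟨htd', he'⟩ := exposed_mem_support h2 hc' hd'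
  by_cases hA : d - t + t' = d'
  · left; omega
  by_cases hB : d' - t' + t = d
  · left; omega
  right
  have m1 : d - t + t' ∈ T + T := absorbed_of_exposure h2 he hA
  have m2 : d' - t' + t ∈ T + T := absorbed_of_exposure h1 he' hB
  have : d + d' = (d - t + t') + (d' - t' + t) := by omega
  rw [this]
  exact Finset.add_mem_add m1 m2

end Source

section MultiShift

variable {K : Type*} [Field K]

/-- Support bookkeeping: if `p - C c * X^d` has all its exponents in `T + T`, then every exponent `n ≠ d` of `p`
lies in `T + T`. [folklore] -/
theorem mem_sumset_of_coeff_ne_zero {T : Finset ℕ} {p : K[X]} {d : ℕ} {c : K}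
    (h : ∀ n ∈ (p - C c * X ^ d).support, n ∈ T + T) {n : ℕ} (hn : p.coeff n ≠ 0) (hnd : n ≠ d) :
    n ∈ T + T := by
  apply h
  rw [Polynomial.mem_support_iff, Polynomial.coeff_sub, Polynomial.coeff_C_mul_X_pow, if_neg hnd, sub_zero]
  exact hn

/-- **MULTI-SHIFT hopping over a `B₃` pool: all successful multipliers of a source are proportional.**
Let the pool `T` be `B₃` and let `g ≠ 0` be a source whose top exponent `deg g` is not in `T`.  If two non-zero
multipliers `h, h'` with exponents in `T` both turn `g` into a monomial up to `T + T`
(`h g ≡ c X^d`, `h' g ≡ c' X^{d'}` with all other exponents in `T + T`; `h ≠ 0`) and the targets avoid the top-born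
exponents `T + deg g`, then `h' = λ h`: precisely `h'.coeff (deg h) • h = h.coeff (deg h) • h'`.
Proof: the top exponent `deg h + deg g` of `h g` is absorbed, so by `absorb_unique_of_B3` every successful multiplier
has the same degree `β`; killing the `β`-coefficient, `h'' = h'_β h − h_β h'` would have a top exponent `τ + deg g`
(`τ ∈ T`, `τ ≠ β`) that is neither absorbed (B₃) nor a target — so `h'' = 0`. [folklore] -/
theorem multipliers_proportional_of_B3 {T : Finset ℕ}
    (hB3 : ∀ a ∈ T, ∀ b ∈ T, ∀ c ∈ T, ∀ a' ∈ T, ∀ b' ∈ T, ∀ c' ∈ T,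
      a + b + c = a' + b' + c' → ({a, b, c} : Multiset ℕ) = {a', b', c'})
    {g h h' : K[X]} (hg0 : g ≠ 0) (hgT : g.natDegree ∉ T) (hh : h ≠ 0)
    (hhT : ∀ t ∈ h.support, t ∈ T) (hh'T : ∀ t ∈ h'.support, t ∈ T) {d d' : ℕ} {c c' : K}
    (h1 : ∀ n ∈ (h * g - C c * X ^ d).support, n ∈ T + T)
    (h2 : ∀ n ∈ (h' * g - C c' * X ^ d').support, n ∈ T + T)
    (hd : ∀ t ∈ T, d ≠ t + g.natDegree) (hd' : ∀ t ∈ T, d' ≠ t + g.natDegree) :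
    h'.coeff h.natDegree • h = h.coeff h.natDegree • h' := by
  set β := h.natDegree with hβ
  set e := g.natDegree with he
  have hβT : β ∈ T := hhT β (Polynomial.natDegree_mem_support_of_nonzero hh)
  -- the top exponent of `h g` is absorbed
  have htop : β + e ∈ T + T := by
    have hne : (h * g).coeff (β + e) ≠ 0 := by
      have hdeg : (h * g).natDegree = β + e := Polynomial.natDegree_mul hh hg0
      rw [← hdeg]
      exact Polynomial.leadingCoeff_ne_zero.mpr (mul_ne_zero hh hg0)
    exact mem_sumset_of_coeff_ne_zero h1 hne (fun hEq => hd β hβT hEq.symm)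
  -- kill the β-coefficient
  set h'' := h'.coeff β • h - h.coeff β • h' with hh''
  by_contra hcon
  have hne'' : h'' ≠ 0 := fun h0 => hcon (sub_eq_zero.mp h0)
  set τ := h''.natDegree with hτ
  have hcoeffβ : h''.coeff β = 0 := by
    simp only [hh'', Polynomial.coeff_sub, Polynomial.coeff_smul, smul_eq_mul]
    ring
  have hτβ : τ ≠ β := by
    intro hEq
    have : h''.coeff τ ≠ 0 := Polynomial.leadingCoeff_ne_zero.mpr hne''
    exact this (hEq ▸ hcoeffβ)
  have hτT : τ ∈ T := by
    have hlead : h''.coeff τ ≠ 0 := Polynomial.leadingCoeff_ne_zero.mpr hne''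
    by_cases hhτ : h.coeff τ ≠ 0
    · exact hhT τ (Polynomial.mem_support_iff.mpr hhτ)
    · push Not at hhτ
      by_cases hh'τ : h'.coeff τ ≠ 0
      · exact hh'T τ (Polynomial.mem_support_iff.mpr hh'τ)
      · push Not at hh'τ
        exfalso; apply hlead
        simp only [hh'', Polynomial.coeff_sub, Polynomial.coeff_smul, smul_eq_mul, hhτ, hh'τ, mul_zero, sub_zero]
  -- the top exponent of `h'' g`
  have htop'' : (h'' * g).coeff (τ + e) ≠ 0 := by
    have hdeg : (h'' * g).natDegree = τ + e := Polynomial.natDegree_mul hne'' hg0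
    rw [← hdeg]
    exact Polynomial.leadingCoeff_ne_zero.mpr (mul_ne_zero hne'' hg0)
  have hexp : (h'' * g).coeff (τ + e) = h'.coeff β * (h * g).coeff (τ + e) - h.coeff β * (h' * g).coeff (τ + e) := by
    simp only [hh'', sub_mul, smul_mul_assoc, Polynomial.coeff_sub, Polynomial.coeff_smul, smul_eq_mul]
  have hτe : τ + e ∈ T + T := by
    by_cases hA : (h * g).coeff (τ + e) ≠ 0
    · exact mem_sumset_of_coeff_ne_zero h1 hA (fun hEq => hd τ hτT hEq.symm)
    · push Not at hA
      have hB : (h' * g).coeff (τ + e) ≠ 0 := by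
        intro hB
        apply htop''
        rw [hexp, hA, hB, mul_zero, mul_zero, sub_zero]
      exact mem_sumset_of_coeff_ne_zero h2 hB (fun hEq => hd' τ hτT hEq.symm)
  exact hτβ (absorb_unique_of_B3 hB3 hgT hτT hβT (add_comm τ e ▸ hτe) (add_comm β e ▸ htop))

/-- **Over a `B₃` pool a source hops at most once, however many shifts are combined.**  With the hypotheses of
`multipliers_proportional_of_B3`, if moreover the second target is genuine (`c' ≠ 0`, `d' ∉ T + T`) then `d' = d`:
every reduced source `g` has at most ONE depth-one target `x^d ∈ x^T·g + span x^{T+T}` off `T + T` and off the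
top-born exponents `T + deg g` (in particular at most one totally-born depth-one target).  This extends
`single_shift_exposure_unique_of_B3` from single shifts `x^t` to arbitrary multipliers `h ∈ span x^T`. [folklore] -/
theorem depth_one_target_unique_of_B3 {T : Finset ℕ}
    (hB3 : ∀ a ∈ T, ∀ b ∈ T, ∀ c ∈ T, ∀ a' ∈ T, ∀ b' ∈ T, ∀ c' ∈ T,
      a + b + c = a' + b' + c' → ({a, b, c} : Multiset ℕ) = {a', b', c'})
    {g h h' : K[X]} (hg0 : g ≠ 0) (hgT : g.natDegree ∉ T) (hh : h ≠ 0)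
    (hhT : ∀ t ∈ h.support, t ∈ T) (hh'T : ∀ t ∈ h'.support, t ∈ T) {d d' : ℕ} {c c' : K}
    (h1 : ∀ n ∈ (h * g - C c * X ^ d).support, n ∈ T + T)
    (h2 : ∀ n ∈ (h' * g - C c' * X ^ d').support, n ∈ T + T)
    (hd : ∀ t ∈ T, d ≠ t + g.natDegree) (hd' : ∀ t ∈ T, d' ≠ t + g.natDegree)
    (hc' : c' ≠ 0) (hdTT : d' ∉ T + T) : d' = d := by
  have hprop := multipliers_proportional_of_B3 hB3 hg0 hgT hh hhT hh'T h1 h2 hd hd'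
  set β := h.natDegree
  have hβ0 : h.coeff β ≠ 0 := Polynomial.leadingCoeff_ne_zero.mpr hh
  -- the coefficient of `h' g` at `d'` is `c' ≠ 0`
  have hc'd : (h' * g).coeff d' = c' := by
    have h0 : (h' * g - C c' * X ^ d').coeff d' = 0 := by
      by_contra hne
      exact hdTT (h2 d' (Polynomial.mem_support_iff.mpr hne))
    rw [Polynomial.coeff_sub, Polynomial.coeff_C_mul_X_pow, if_pos rfl, sub_eq_zero] at h0
    exact h0
  -- hence the coefficient of `h g` at `d'` is non-zero
  have hcoef : h.coeff β * (h' * g).coeff d' = h'.coeff β * (h * g).coeff d' := by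
    have := congrArg (fun p : K[X] => (p * g).coeff d') hprop
    simp only [smul_mul_assoc, Polynomial.coeff_smul, smul_eq_mul] at this
    exact this.symm
  have hne : (h * g).coeff d' ≠ 0 := by
    intro h0
    rw [h0, mul_zero, hc'd] at hcoef
    exact (mul_ne_zero hβ0 hc') hcoef
  by_contra hdd
  exact hdTT (mem_sumset_of_coeff_ne_zero h1 hne hdd)

end MultiShift

end PolySwallowForcesShortRelation.Negative.TermHop

end Summit.ValiantsHypothesis.ValiantsHypothesis.Theorems
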